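import Literature.AlgebraicGeometry.HodgeTheory.CyclicReflectionComplexification
import HarnessLib

/-!
# Eigen-projectors of an automorphism of finite order on the complexification (Carlson–Toledo 1999 §§2, 7:
# "the complex vanishing cycles … are by definition the eigencomponents of ordinary vanishing cycles") —
# packaging, part 2

Family `hodge`, layer `Literature/AlgebraicGeometry/HodgeTheory`. THEOREMS + one definition. Sequel of
`CyclicReflectionComplexification` (R1 of memo STUB-PLAN-B2-g19 / (a) of LANE-D-ROADMAP-Ax-g0, crux K1 of
`Summits/HodgeConjecture/HodgeConjecture/Theses/CyclicUnitaryPowers.lean`). For `τ : V →ₗ[ℚ] V` with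
`τ^p = 1` and a primitive `p`-th root of unity `ζ`, the EIGEN-PROJECTORS
`π_j = (1/p) Σ_{i<p} ζ^{-ij} (τ ⊗ ℂ)^i` onto `H(ζ^j) = ker(τ ⊗ ℂ − ζ^j)`: polynomial in `τ`, hence commuting
with everything that commutes with `τ` (the monodromy group), with `Σ_j π_j = 1`, `π_j = 1` on `H(ζ^j)` and
`= 0` on `H(ζ^k)`, `k ≢ j`. This is how the source passes from a (rational) vanishing cycle `δ` to its complex
eigencomponents `δ_i ∈ H(ζ^i)` along which the local monodromy is a complex reflection (§6 Proposition, §7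
last paragraph). Written by the prover seat `hodge-nonav-prover-Ax`.

## What is proved (`V` a `ℚ`-space, `τ : V →ₗ[ℚ] V`, `ζ : ℂ`)
* `cyclicEigenProjector τ p ζ j` (DEFINITION; the abstract analogue, for a rational `τ` of finite order on any
  `ℚ`-space, of the model-side isotypic projector `eigenProjector` of `DiagonalCharacterEigenspace`) and
  `cyclicEigenProjector_apply`.
* `baseChange_comp_cyclicEigenProjector` — `τ_ℂ ∘ π_j = ζ^j • π_j` when `τ^p = 1`, `ζ^p = 1`, `ζ ≠ 0`; hence
  **`cyclicEigenProjector_mem_eigenspace`** (`π_j x ∈ H(ζ^j)`).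
* **`cyclicEigenProjector_apply_of_mem_eigenspace_self`** / **`_of_ne`** — `π_j = id` on `H(ζ^j)`, `= 0` on `H(ζ^k)`
  for `ζ` primitive and `k ≢ j (mod p)`.
* **`sum_cyclicEigenProjector`** — `Σ_{j<p} π_j x = x` (`ζ` primitive).
* `comp_cyclicEigenProjector_of_comm` — maps commuting with `τ_ℂ` commute with every `π_j`.

## References
* [CarlsonToledo1999] J. A. Carlson, D. Toledo, Duke Math. J. 97 (1999), §2 p. 5 ("`H^{n+1}(Y,ℂ)₀ = ⊕ H(μ)`"),
  §7 p. 16 ("the 'complex vanishing cycles' … are by definition the eigencomponents of ordinary vanishing cycles").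
-/

noncomputable section

open Module Literature.AlgebraicGeometry.Motives
open scoped TensorProduct ComplexConjugate

namespace Literature.AlgebraicGeometry.HodgeTheory

universe v

variable {V : Type v} [AddCommGroup V] [Module ℚ V]

/-- **The eigen-projector** `π_j = (1/p) Σ_{i<p} ζ^{-ij} (τ ⊗ ℂ)^i` of `τ` for the eigenvalue `ζ^j`
("eigencomponents", Carlson–Toledo §7). [cite: CarlsonToledo1999, §7 (p. 16)] -/
def cyclicEigenProjector (τ : V →ₗ[ℚ] V) (p : ℕ) (ζ : ℂ) (j : ℕ) : ℂ ⊗[ℚ] V →ₗ[ℂ] ℂ ⊗[ℚ] V :=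
  (p : ℂ)⁻¹ • ∑ i ∈ Finset.range p, (ζ⁻¹) ^ (i * j) • (τ.baseChange ℂ) ^ i

/-- [cite: CarlsonToledo1999, §7 (p. 16)] -/
theorem cyclicEigenProjector_apply (τ : V →ₗ[ℚ] V) (p : ℕ) (ζ : ℂ) (j : ℕ) (x : ℂ ⊗[ℚ] V) :
    cyclicEigenProjector τ p ζ j x = (p : ℂ)⁻¹ • ∑ i ∈ Finset.range p, (ζ⁻¹) ^ (i * j) • ((τ.baseChange ℂ) ^ i) x := by
  simp [cyclicEigenProjector, LinearMap.sum_apply]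

/-- Shifting a sum over `range p` of a `p`-periodic sequence. [folklore] -/
private theorem sum_range_shift {M : Type*} [AddCommGroup M] (f : ℕ → M) (p : ℕ) (h : f p = f 0) :
    ∑ i ∈ Finset.range p, f (i + 1) = ∑ i ∈ Finset.range p, f i := by
  have h1 : ∑ i ∈ Finset.range p, f (i + 1) + f 0 = ∑ i ∈ Finset.range p, f i + f p := by
    rw [← Finset.sum_range_succ', Finset.sum_range_succ]
  rw [h] at h1
  exact add_right_cancel h1

/-- **`τ_ℂ ∘ π_j = ζ^j • π_j`** (for `τ^p = 1`, `ζ^p = 1`, `ζ ≠ 0`): the image of `π_j` lies in the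
`ζ^j`-eigenspace. [cite: CarlsonToledo1999, §7 (p. 16)] -/
theorem baseChange_comp_cyclicEigenProjector {τ : V →ₗ[ℚ] V} {p : ℕ} (hτ : τ ^ p = 1) {ζ : ℂ} (hζ : ζ ^ p = 1)
    (hζ0 : ζ ≠ 0) (j : ℕ) :
    (τ.baseChange ℂ) ∘ₗ cyclicEigenProjector τ p ζ j = ζ ^ j • cyclicEigenProjector τ p ζ j := by
  have hτC : (τ.baseChange ℂ) ^ p = 1 := by
    rw [← LinearMap.baseChange_pow, hτ, LinearMap.baseChange_one]
  refine LinearMap.ext fun x => ?_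
  rw [LinearMap.comp_apply, LinearMap.smul_apply, cyclicEigenProjector_apply, map_smul, map_sum, smul_comm (ζ ^ j)]
  congr 1
  -- `Σ_i ζ^{-ij} τ^{i+1} x = ζ^j Σ_i ζ^{-ij} τ^i x`, reindexing with `τ^p = 1`, `ζ^{-pj} = 1`
  have key : ∀ i : ℕ, (τ.baseChange ℂ) (((ζ⁻¹) ^ (i * j)) • ((τ.baseChange ℂ) ^ i) x) =
      ζ ^ j • (((ζ⁻¹) ^ ((i + 1) * j)) • ((τ.baseChange ℂ) ^ (i + 1)) x) := by
    intro i
    rw [map_smul, smul_smul, pow_succ', Module.End.mul_apply]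
    congr 1
    rw [add_mul, one_mul, pow_add, ← mul_assoc, mul_comm (ζ ^ j), mul_assoc, ← mul_pow, mul_inv_cancel₀ hζ0,
      one_pow, mul_one]
  simp only [key, ← Finset.smul_sum]
  congr 1
  refine sum_range_shift (fun i => (ζ⁻¹) ^ (i * j) • ((τ.baseChange ℂ) ^ i) x) p ?_
  simp only [zero_mul, pow_zero, one_smul, Module.End.one_apply, hτC]
  rw [inv_pow, pow_mul, hζ, one_pow, inv_one, one_smul]

/-- **`π_j x ∈ H(ζ^j)`**. [cite: CarlsonToledo1999, §7 (p. 16)] -/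
theorem cyclicEigenProjector_mem_eigenspace {τ : V →ₗ[ℚ] V} {p : ℕ} (hτ : τ ^ p = 1) {ζ : ℂ} (hζ : ζ ^ p = 1)
    (hζ0 : ζ ≠ 0) (j : ℕ) (x : ℂ ⊗[ℚ] V) :
    cyclicEigenProjector τ p ζ j x ∈ Module.End.eigenspace (τ.baseChange ℂ) (ζ ^ j) := by
  rw [Module.End.mem_eigenspace_iff]
  have h := congrArg (fun f => f x) (baseChange_comp_cyclicEigenProjector hτ hζ hζ0 j)
  simpa using h

/-- On an eigenvector of `τ_ℂ` with eigenvalue `ζ^k`, `π_j` multiplies by `(1/p) Σ_{i<p} (ζ^{-j} ζ^k)^i`.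
[cite: CarlsonToledo1999, §7 (p. 16)] -/
theorem cyclicEigenProjector_apply_of_mem_eigenspace {τ : V →ₗ[ℚ] V} {p : ℕ} {ζ : ℂ} (j k : ℕ) {x : ℂ ⊗[ℚ] V}
    (hx : x ∈ Module.End.eigenspace (τ.baseChange ℂ) (ζ ^ k)) :
    cyclicEigenProjector τ p ζ j x = ((p : ℂ)⁻¹ * ∑ i ∈ Finset.range p, ((ζ⁻¹) ^ j * ζ ^ k) ^ i) • x := by
  rw [Module.End.mem_eigenspace_iff] at hx
  have hpow : ∀ i : ℕ, ((τ.baseChange ℂ) ^ i) x = (ζ ^ k) ^ i • x := by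
    intro i
    induction i with
    | zero => simp
    | succ i ih => rw [pow_succ, Module.End.mul_apply, hx, map_smul, ih, smul_smul, pow_succ']
  rw [cyclicEigenProjector_apply, mul_smul, Finset.sum_smul]
  congr 1
  refine Finset.sum_congr rfl fun i _ => ?_
  rw [hpow, smul_smul]
  congr 1
  rw [mul_pow, ← pow_mul, ← pow_mul, mul_comm j i, mul_comm k i]

/-- **`π_j = id` on `H(ζ^j)`** (`p ≠ 0`, `ζ ≠ 0`). [cite: CarlsonToledo1999, §7 (p. 16)] -/
theorem cyclicEigenProjector_apply_of_mem_eigenspace_self {τ : V →ₗ[ℚ] V} {p : ℕ} (hp : p ≠ 0) {ζ : ℂ}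
    (hζ0 : ζ ≠ 0) (j : ℕ) {x : ℂ ⊗[ℚ] V} (hx : x ∈ Module.End.eigenspace (τ.baseChange ℂ) (ζ ^ j)) :
    cyclicEigenProjector τ p ζ j x = x := by
  rw [cyclicEigenProjector_apply_of_mem_eigenspace j j hx, inv_pow, inv_mul_cancel₀ (pow_ne_zero j hζ0)]
  simp [Finset.sum_const, Finset.card_range, inv_mul_cancel₀ (Nat.cast_ne_zero.2 hp : (p : ℂ) ≠ 0)]

/-- **`π_j = 0` on `H(ζ^k)` for `k ≢ j (mod p)`** (`ζ` a primitive `p`-th root of unity): the geometric sum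
`Σ_{i<p} ω^i` of a `p`-th root of unity `ω ≠ 1` vanishes. [cite: CarlsonToledo1999, §7 (p. 16)] -/
theorem cyclicEigenProjector_apply_of_mem_eigenspace_of_ne {τ : V →ₗ[ℚ] V} {p : ℕ} {ζ : ℂ} (hζ : IsPrimitiveRoot ζ p)
    (hp : 0 < p) {j k : ℕ} (hjk : ¬ (p : ℤ) ∣ (k : ℤ) - j) {x : ℂ ⊗[ℚ] V}
    (hx : x ∈ Module.End.eigenspace (τ.baseChange ℂ) (ζ ^ k)) :
    cyclicEigenProjector τ p ζ j x = 0 := by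
  rw [cyclicEigenProjector_apply_of_mem_eigenspace j k hx]
  have hζ0 : ζ ≠ 0 := hζ.ne_zero hp.ne'
  set ω : ℂ := (ζ⁻¹) ^ j * ζ ^ k with hω
  have hωp : ω ^ p = 1 := by
    rw [hω, mul_pow, ← pow_mul, ← pow_mul, inv_pow, mul_comm j p, mul_comm k p, pow_mul, pow_mul, hζ.pow_eq_one,
      one_pow, one_pow, inv_one, one_mul]
  have hω1 : ω ≠ 1 := by
    intro h1
    apply hjk
    -- `ζ^k = ζ^j` forces `k ≡ j (mod p)`
    have hzpow : ζ ^ k = ζ ^ j := by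
      have := congrArg (fun z => ζ ^ j * z) h1
      simp only [hω, mul_one, ← mul_assoc, ← mul_pow, mul_inv_cancel₀ hζ0, one_pow, one_mul] at this
      exact this
    have hu := (hζ.zpow_eq_one_iff_dvd ((k : ℤ) - j)).1 (by
      rw [zpow_sub₀ hζ0, zpow_natCast, zpow_natCast, hzpow, div_self (pow_ne_zero j hζ0)])
    exact hu
  rw [geom_sum_eq hω1, hωp, sub_self, zero_div, mul_zero, zero_smul]

/-- **`Σ_{j<p} π_j = id`** (`ζ` a primitive `p`-th root of unity): `Σ_j ζ^{-ij} = 0` for `0 < i < p` and `= p`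
for `i = 0`. [cite: CarlsonToledo1999, §2 (p. 5)] -/
theorem sum_cyclicEigenProjector {τ : V →ₗ[ℚ] V} {p : ℕ} {ζ : ℂ} (hζ : IsPrimitiveRoot ζ p) (hp : 0 < p)
    (x : ℂ ⊗[ℚ] V) : ∑ j ∈ Finset.range p, cyclicEigenProjector τ p ζ j x = x := by
  have hζ0 : ζ ≠ 0 := hζ.ne_zero hp.ne'
  simp only [cyclicEigenProjector_apply]
  rw [← Finset.smul_sum, Finset.sum_comm]
  -- inner sums over `j`: `Σ_j (ζ^{-i})^j = p · [i = 0]`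
  have inner : ∀ i ∈ Finset.range p, ∑ j ∈ Finset.range p, (ζ⁻¹) ^ (i * j) • ((τ.baseChange ℂ) ^ i) x =
      if i = 0 then (p : ℂ) • x else 0 := by
    intro i hi
    simp only [pow_mul, ← Finset.sum_smul]
    split_ifs with h0
    · subst h0
      simp [Finset.sum_const, Finset.card_range]
    · have hlt : i < p := Finset.mem_range.1 hi
      have hne : (ζ⁻¹) ^ i ≠ 1 := by
        intro h1
        have : ζ ^ i = 1 := by
          have h2 := congrArg (fun z => z⁻¹) h1
          simpa [inv_pow] using h2
        exact (hζ.pow_ne_one_of_pos_of_lt h0 hlt) this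
      have hpow : ((ζ⁻¹) ^ i) ^ p = 1 := by rw [← pow_mul, mul_comm, pow_mul, inv_pow, hζ.pow_eq_one, inv_one, one_pow]
      rw [geom_sum_eq hne, hpow, sub_self, zero_div, zero_smul]
  rw [Finset.sum_congr rfl inner, Finset.sum_ite_eq' (Finset.range p) 0 (fun _ => (p : ℂ) • x)]
  simp only [Finset.mem_range, hp, ↓reduceIte, smul_smul, inv_mul_cancel₀ (Nat.cast_ne_zero.2 hp.ne' : (p : ℂ) ≠ 0),
    one_smul]

/-- **Maps commuting with `τ_ℂ` commute with every eigen-projector** (`π_j` is a polynomial in `τ_ℂ`).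
[cite: CarlsonToledo1999, §2 (p. 5)] -/
theorem comp_cyclicEigenProjector_of_comm {τ : V →ₗ[ℚ] V} {f : ℂ ⊗[ℚ] V →ₗ[ℂ] ℂ ⊗[ℚ] V}
    (hf : f ∘ₗ (τ.baseChange ℂ) = (τ.baseChange ℂ) ∘ₗ f) (p : ℕ) (ζ : ℂ) (j : ℕ) :
    f ∘ₗ cyclicEigenProjector τ p ζ j = cyclicEigenProjector τ p ζ j ∘ₗ f := by
  have hpow : ∀ (i : ℕ) (x : ℂ ⊗[ℚ] V), f (((τ.baseChange ℂ) ^ i) x) = ((τ.baseChange ℂ) ^ i) (f x) := by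
    intro i
    induction i with
    | zero => intro x; simp
    | succ i ih =>
      intro x
      have hfx := congrArg (fun g => g (((τ.baseChange ℂ) ^ i) x)) hf
      simp only [LinearMap.coe_comp, Function.comp_apply] at hfx
      rw [pow_succ', Module.End.mul_apply, Module.End.mul_apply, hfx, ih]
  refine LinearMap.ext fun x => ?_
  rw [LinearMap.comp_apply, LinearMap.comp_apply, cyclicEigenProjector_apply, cyclicEigenProjector_apply, map_smul, map_sum]
  congr 1
  refine Finset.sum_congr rfl fun i _ => ?_
  rw [map_smul, hpow]

/-- Conjugation commutes with the powers of the rational `τ_ℂ`. [cite: CarlsonToledo1999, §2 (p. 5)] -/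
theorem conjV_baseChange_pow (τ : V →ₗ[ℚ] V) (i : ℕ) (x : ℂ ⊗[ℚ] V) :
    conjV V (((τ.baseChange ℂ) ^ i) x) = ((τ.baseChange ℂ) ^ i) (conjV V x) := by
  induction i generalizing x with
  | zero => simp
  | succ i ih => rw [pow_succ, Module.End.mul_apply, Module.End.mul_apply, ih, conjV_baseChange]

/-- **Conjugation intertwines the eigen-projectors for `ζ` and `ζ̄`**: `conj (π_j^ζ x) = π_j^{ζ̄} (conj x)` —
the eigencomponent of `x̄` in `H(ζ̄^j) = conj H(ζ^j)` is the conjugate of the eigencomponent of `x`.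
[cite: CarlsonToledo1999, §2 (p. 5)] -/
theorem conjV_cyclicEigenProjector (τ : V →ₗ[ℚ] V) (p : ℕ) (ζ : ℂ) (j : ℕ) (x : ℂ ⊗[ℚ] V) :
    conjV V (cyclicEigenProjector τ p ζ j x) = cyclicEigenProjector τ p (conj ζ) j (conjV V x) := by
  rw [cyclicEigenProjector_apply, cyclicEigenProjector_apply, LinearMap.map_smulₛₗ, map_sum]
  congr 1
  · simp
  · refine Finset.sum_congr rfl fun i _ => ?_
    rw [LinearMap.map_smulₛₗ, conjV_baseChange_pow, map_pow, map_inv₀]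

end Literature.AlgebraicGeometry.HodgeTheory

end
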